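import Summits.CriticalPhenomena.PercolationContinuityZ3.Theorems.PercNearOneGluingNoHeavyLowerTailSahiLatinDescent
import Literature.Combinatorics.Sahi2008.Indicators

/-!
# `NoHeavyLowerTail` (crux stmt-CriticalPhenomena-4575), Sahi programme (prim-master-conj gen 42): the FULL-POLARISATION BRIDGE in
# EVERY dimension — `κ_d ≥ 0` on up-set triples of `[3]^d` (equivalently: on the TERMINAL ones) implies Sahi's `E₃ ≥ 0` on every
# product of `d` finite chains with every product probability weight

Support file (`--supports stmt-CriticalPhenomena-4575`; companion of `…SahiLatinKernel/Moves/Descent`; the `d = 3` instance with the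
explicit triple product `Fin m₁ × Fin m₂ × Fin m₃` and the in-kernel check of `[3]³` is gen 40's `…SahiThreeChainsBridgePolar/…BridgeKernel`).
Memo `run/shared/lean/prim/prim-l12/FROM-prim-master-conj-g40-FULL-POLARISATION.md` §1, `…-g41-DESCENT.md` §9 (L5).

For a finite type `P` with a probability weight `μ` and finsets `a, b, c ⊆ P`:
* `sahiE_three_setInd_eq_sum_trip` — `E₃(1_a,1_b,1_c) = Σ_{t : Fin 3 → P} (Π_j μ(t j)) · G_{abc}(t₀,t₁,t₂)` (three independent copies; `G`
  is the integer integrand of `…SahiLatinKernel`, `Gr` its real form).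
For `P = Π_{i:ι} α_i` (each `α_i` a finite linear order) with a PRODUCT weight `prodW w p = Π_i w_i(p_i)`:
* `act π t` — the action of `π : ι → Perm (Fin 3)` on triples (on each axis separately, permute which copy carries which coordinate);
  `W3_act` — the weight `Π_j μ(t j)` is invariant; `sum_trip_eq_sum_orbitAvg` — hence `Σ_t W G = Σ_t W · (Σ_π G(π·t)) / 6^d`;
* `psi`, `pull` — sorting each axis of `t` gives a monotone map `ψ_t : [3]^ι → P`, pull-backs of up-sets are up-sets (`isUpperSet_pull`),
  and **`orbitSum_eq_kappa`**: `Σ_π G_{abc}(π·t) = κ(ψ_t^* a, ψ_t^* b, ψ_t^* c)` — the Latin kernel of the pulled-back triple;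
* **`sahiPositive_three_prodW`**: `LatinPos ι` (FBP(3,|ι|)) ⟹ `SahiPositive (prodW w) 3` for all nonnegative `w` with `Σ_p prodW w p = 1`;
  marginal form `sahiPositive_three_prodW'` (`Σ_x w_i x = 1` for each `i`); and via the descent theorem
  **`sahiPositive_three_of_terminalPos`**: TERMINAL POSITIVITY of `[3]^ι` ⟹ Sahi's `E₃(f,g,h) ≥ 0` for all nonnegative monotone
  `f, g, h` on `Π_i α_i` under every product probability weight.
So for each `d` the order-3 case of Sahi's conjecture [Sahi2008, Conj. 5] on all products of `d` finite chains (hence on `[0,1]^d` with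
product measures, [LiebSahi2022, Lemma 2.3]) is reduced IN THE KERNEL to the finite statement `TerminalPos (Fin d)`; `d = 3` is the tree
theorem `SahiThreeChains.sahiPositive_three_prodWeight₃'` (gen 40, exhaustive check), `d = 4` is enumerated outside Lean (memo g41 §4:
76 380 564 165 terminal triples, `0` negative).  Everything here is proved; axioms standard.
-/

namespace Summit.CriticalPhenomena.PercolationContinuityZ3.Theorems.SahiLatin

open Finset Literature.Combinatorics.Sahi2008

/-! ## Three independent copies: `E₃` of indicators as a sum over triples (any finite type) -/

section Polar

variable {P : Type*} [Fintype P] [DecidableEq P]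

/-- The weight `Π_j μ (t j)` of a triple of independent copies. [this work] -/
def W3 (μ : P → ℝ) (t : Fin 3 → P) : ℝ := ∏ j, μ (t j)

/-- Real `0/1` indicator of a finset (`= setInd`, `= ↑ind`). [this work] -/
def chi (s : Finset P) (p : P) : ℝ := if p ∈ s then 1 else 0

omit [Fintype P] in
/-- `chi = setInd`. [this work] -/
theorem chi_eq_setInd (s : Finset P) : chi s = setInd s := rfl

omit [Fintype P] in
/-- `↑(ind s x) = chi s x`. [this work] -/
theorem cast_ind (s : Finset P) (x : P) : ((ind s x : ℤ) : ℝ) = chi s x := by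
  unfold ind chi; split_ifs <;> simp

/-- The real form of the integrand `G_{abc}` on a triple. [this work] -/
def Gr (a b c : Finset P) (t : Fin 3 → P) : ℝ :=
  2 * (chi a (t 0) * chi b (t 0) * chi c (t 0)) - chi a (t 0) * (chi b (t 1) * chi c (t 1))
    - chi b (t 0) * (chi a (t 1) * chi c (t 1)) - chi c (t 0) * (chi a (t 1) * chi b (t 1))
    + chi a (t 0) * chi b (t 1) * chi c (t 2)

omit [Fintype P] in
/-- `Gr` is the cast of the integer integrand `G`. [this work] -/
theorem Gr_eq_cast (a b c : Finset P) (t : Fin 3 → P) : Gr a b c t = ((G a b c (t 0) (t 1) (t 2) : ℤ) : ℝ) := by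
  simp only [Gr, G]; push_cast; simp only [cast_ind]

omit [DecidableEq P] in
/-- Three independent copies: `Π_j E_μ(F_j) = Σ_t W(t) Π_j F_j(t_j)`. [this work] -/
theorem prod_ex_eq_sum_trip (μ : P → ℝ) (F : Fin 3 → P → ℝ) :
    ∏ j, ex μ (F j) = ∑ t : Fin 3 → P, W3 μ t * ∏ j, F j (t j) := by
  simp only [ex]
  rw [Fintype.prod_sum (fun j p => μ p * F j p)]
  refine sum_congr rfl fun t _ => ?_
  rw [W3, ← prod_mul_distrib]

/-- **`E₃` of three indicators as a sum over triples of independent copies** (probability weight, any finite type). [this work] -/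
theorem sahiE_three_setInd_eq_sum_trip (μ : P → ℝ) (hμ : ∑ p, μ p = 1) (a b c : Finset P) :
    sahiE μ 3 ![setInd a, setInd b, setInd c] = ∑ t : Fin 3 → P, W3 μ t * Gr a b c t := by
  have h1 : ex μ 1 = 1 := ex_one hμ
  have e1 : ex μ (chi a * chi b * chi c) * ex μ 1 * ex μ 1 =
      ∑ t : Fin 3 → P, W3 μ t * (chi a (t 0) * chi b (t 0) * chi c (t 0)) := by
    have := prod_ex_eq_sum_trip μ ![chi a * chi b * chi c, 1, 1]
    rw [Fin.prod_univ_three] at this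
    simp only [Matrix.cons_val_zero, Matrix.cons_val_one, Matrix.cons_val] at this
    rw [this]
    refine sum_congr rfl fun t _ => ?_
    rw [Fin.prod_univ_three]
    simp
  have e2 : ∀ (u v w : Finset P), ex μ (chi u) * ex μ (chi v * chi w) * ex μ 1 =
      ∑ t : Fin 3 → P, W3 μ t * (chi u (t 0) * (chi v (t 1) * chi w (t 1))) := by
    intro u v w
    have := prod_ex_eq_sum_trip μ ![chi u, chi v * chi w, 1]
    rw [Fin.prod_univ_three] at this
    simp only [Matrix.cons_val_zero, Matrix.cons_val_one, Matrix.cons_val] at this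
    rw [this]
    refine sum_congr rfl fun t _ => ?_
    rw [Fin.prod_univ_three]
    simp
  have e3 : ex μ (chi a) * ex μ (chi b) * ex μ (chi c) =
      ∑ t : Fin 3 → P, W3 μ t * (chi a (t 0) * chi b (t 1) * chi c (t 2)) := by
    have := prod_ex_eq_sum_trip μ ![chi a, chi b, chi c]
    rw [Fin.prod_univ_three] at this
    simp only [Matrix.cons_val_zero, Matrix.cons_val_one, Matrix.cons_val] at this
    rw [this]
    refine sum_congr rfl fun t _ => ?_
    rw [Fin.prod_univ_three]
    simp [mul_assoc]
  rw [sahiE_three, ← chi_eq_setInd, ← chi_eq_setInd, ← chi_eq_setInd]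
  have hG : ∑ t : Fin 3 → P, W3 μ t * Gr a b c t =
      2 * ∑ t : Fin 3 → P, W3 μ t * (chi a (t 0) * chi b (t 0) * chi c (t 0))
      - ∑ t : Fin 3 → P, W3 μ t * (chi a (t 0) * (chi b (t 1) * chi c (t 1)))
      - ∑ t : Fin 3 → P, W3 μ t * (chi b (t 0) * (chi a (t 1) * chi c (t 1)))
      - ∑ t : Fin 3 → P, W3 μ t * (chi c (t 0) * (chi a (t 1) * chi b (t 1)))
      + ∑ t : Fin 3 → P, W3 μ t * (chi a (t 0) * chi b (t 1) * chi c (t 2)) := by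
    simp only [Gr, mul_sum, ← sum_sub_distrib, ← sum_add_distrib]
    exact sum_congr rfl fun t _ => by ring
  rw [hG, ← e1, ← e2 a b c, ← e2 b a c, ← e2 c a b, ← e3, h1]
  ring

end Polar

/-! ## Product spaces `Π_i α_i`: the axiswise action of `(Perm (Fin 3))^ι` on triples -/

section Pi

variable {ι : Type*} [Fintype ι] [DecidableEq ι] {α : ι → Type*} [∀ i, Fintype (α i)] [∀ i, LinearOrder (α i)]

/-- The product weight `p ↦ Π_i w_i (p_i)`. [this work] -/
def prodW (w : ∀ i, α i → ℝ) : (∀ i, α i) → ℝ := fun p => ∏ i, w i (p i)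

/-- `π · t`: on each axis `i` separately, copy `j` receives the `i`-th coordinate of copy `π i j`. [this work] -/
def act (π : LPerm ι) (t : Fin 3 → ∀ i, α i) : Fin 3 → ∀ i, α i := fun j i => t (π i j) i

omit [Fintype ι] [DecidableEq ι] [∀ i, Fintype (α i)] [∀ i, LinearOrder (α i)] in
/-- The identity acts trivially. [this work] -/
theorem act_one (t : Fin 3 → ∀ i, α i) : act (1 : LPerm ι) t = t := by
  funext j i; simp [act]

omit [Fintype ι] [DecidableEq ι] [∀ i, Fintype (α i)] [∀ i, LinearOrder (α i)] in
/-- The action is an anti-homomorphism: `(πρ) · t = ρ · (π · t)`. [this work] -/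
theorem act_mul (π ρ : LPerm ι) (t : Fin 3 → ∀ i, α i) : act (π * ρ) t = act ρ (act π t) := by
  funext j i; simp [act, Pi.mul_apply, Equiv.Perm.mul_apply]

/-- The action of `π` as a bijection of the triples. [this work] -/
def actEquiv (π : LPerm ι) : (Fin 3 → ∀ i, α i) ≃ (Fin 3 → ∀ i, α i) where
  toFun := act π
  invFun := act π⁻¹
  left_inv t := by show act π⁻¹ (act π t) = t; rw [← act_mul, mul_inv_cancel, act_one]
  right_inv t := by show act π (act π⁻¹ t) = t; rw [← act_mul, inv_mul_cancel, act_one]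

omit [DecidableEq ι] [∀ i, Fintype (α i)] [∀ i, LinearOrder (α i)] in
/-- The weight of a triple is invariant under the action (each axis keeps its multiset of coordinates). [this work] -/
theorem W3_act (w : ∀ i, α i → ℝ) (π : LPerm ι) (t : Fin 3 → ∀ i, α i) : W3 (prodW w) (act π t) = W3 (prodW w) t := by
  simp only [W3, prodW, act]
  rw [Finset.prod_comm, Finset.prod_comm (s := (univ : Finset (Fin 3)))]
  refine prod_congr rfl fun i _ => ?_
  exact Equiv.prod_comp (π i) (fun j => w i (t j i))

omit [∀ i, LinearOrder (α i)] in
/-- Re-indexing the triple sum by the action. [this work] -/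
theorem sum_trip_act (w : ∀ i, α i → ℝ) (F : (Fin 3 → ∀ i, α i) → ℝ) (π : LPerm ι) :
    ∑ t : Fin 3 → ∀ i, α i, W3 (prodW w) t * F (act π t) = ∑ t : Fin 3 → ∀ i, α i, W3 (prodW w) t * F t := by
  rw [← Equiv.sum_comp (actEquiv (α := α) π) (fun t => W3 (prodW w) t * F t)]
  refine sum_congr rfl fun t _ => ?_
  show W3 (prodW w) t * F (act π t) = W3 (prodW w) (act π t) * F (act π t)
  rw [W3_act]

omit [∀ i, LinearOrder (α i)] in
/-- **Orbit averaging**: `Σ_t W(t) F(t) = Σ_t W(t) · (Σ_π F(π·t)) / |(Perm (Fin 3))^ι|`. [this work] -/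
theorem sum_trip_eq_sum_orbitAvg (w : ∀ i, α i → ℝ) (F : (Fin 3 → ∀ i, α i) → ℝ) :
    ∑ t : Fin 3 → ∀ i, α i, W3 (prodW w) t * F t =
      ∑ t : Fin 3 → ∀ i, α i, W3 (prodW w) t * ((∑ π : LPerm ι, F (act π t)) / Fintype.card (LPerm ι)) := by
  have hN : (Fintype.card (LPerm ι) : ℝ) ≠ 0 := by exact_mod_cast Fintype.card_ne_zero
  have key : ∑ t : Fin 3 → ∀ i, α i, W3 (prodW w) t * (∑ π : LPerm ι, F (act π t)) =
      (Fintype.card (LPerm ι) : ℝ) * ∑ t : Fin 3 → ∀ i, α i, W3 (prodW w) t * F t := by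
    calc ∑ t : Fin 3 → ∀ i, α i, W3 (prodW w) t * (∑ π : LPerm ι, F (act π t))
        = ∑ t : Fin 3 → ∀ i, α i, ∑ π : LPerm ι, W3 (prodW w) t * F (act π t) := by simp_rw [mul_sum]
      _ = ∑ π : LPerm ι, ∑ t : Fin 3 → ∀ i, α i, W3 (prodW w) t * F (act π t) := sum_comm
      _ = ∑ π : LPerm ι, ∑ t : Fin 3 → ∀ i, α i, W3 (prodW w) t * F t := sum_congr rfl fun π _ => sum_trip_act w F π
      _ = (Fintype.card (LPerm ι) : ℝ) * ∑ t : Fin 3 → ∀ i, α i, W3 (prodW w) t * F t := by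
          rw [sum_const, card_univ, nsmul_eq_mul]
  symm
  calc ∑ t : Fin 3 → ∀ i, α i, W3 (prodW w) t * ((∑ π : LPerm ι, F (act π t)) / Fintype.card (LPerm ι))
      = (∑ t : Fin 3 → ∀ i, α i, W3 (prodW w) t * (∑ π : LPerm ι, F (act π t))) / Fintype.card (LPerm ι) := by
        rw [sum_div]
        exact sum_congr rfl fun t _ => by ring
    _ = ∑ t : Fin 3 → ∀ i, α i, W3 (prodW w) t * F t := by
        rw [key, mul_div_cancel_left₀ _ hN]

omit [DecidableEq ι] [∀ i, Fintype (α i)] [∀ i, LinearOrder (α i)] in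
/-- The weight of a triple is nonnegative for nonnegative marginal weights. [this work] -/
theorem W3_nonneg {w : ∀ i, α i → ℝ} (hw : ∀ i x, 0 ≤ w i x) (t : Fin 3 → ∀ i, α i) : 0 ≤ W3 (prodW w) t :=
  prod_nonneg fun _ _ => prod_nonneg fun _ _ => hw _ _

omit [∀ i, LinearOrder (α i)] in
/-- Reduction to orbit sums: if `Σ_π G_{abc}(π·t) ≥ 0` for every triple `t`, then `E₃(1_a,1_b,1_c) ≥ 0` under a product
probability weight. [this work] -/
theorem sahiE_three_setInd_nonneg_of_orbitSum_nonneg [∀ i, DecidableEq (α i)] {w : ∀ i, α i → ℝ} (hw : ∀ i x, 0 ≤ w i x)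
    (hμ : ∑ p, prodW w p = 1) (a b c : Finset (∀ i, α i))
    (horb : ∀ t : Fin 3 → ∀ i, α i, 0 ≤ ∑ π : LPerm ι, Gr a b c (act π t)) :
    0 ≤ sahiE (prodW w) 3 ![setInd a, setInd b, setInd c] := by
  rw [sahiE_three_setInd_eq_sum_trip _ hμ, sum_trip_eq_sum_orbitAvg]
  exact sum_nonneg fun t _ => mul_nonneg (W3_nonneg hw t) (div_nonneg (horb t) (Nat.cast_nonneg _))

/-! ## Sorting pull-back: orbit sums are Latin kernels -/

/-- The sorting permutation of axis `i` of the triple `t`: `j ↦ t (srt t i j) i` is monotone. [this work] -/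
def srt (t : Fin 3 → ∀ i, α i) (i : ι) : Equiv.Perm (Fin 3) := Tuple.sort fun j => t j i

/-- The monotone map `ψ_t : [3]^ι → Π_i α_i`, `q ↦ (i ↦ the q_i-th smallest i-th coordinate of t)`. [this work] -/
def psi (t : Fin 3 → ∀ i, α i) (q : Pt ι) : ∀ i, α i := fun i => t (srt t i (q i)) i

omit [Fintype ι] [DecidableEq ι] [∀ i, Fintype (α i)] in
/-- `ψ_t` is monotone. [this work] -/
theorem psi_monotone (t : Fin 3 → ∀ i, α i) : Monotone (psi t) :=
  fun _ _ h i => Tuple.monotone_sort (fun j => t j i) (h i)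

/-- The pull-back of a subset along `ψ_t`. [this work] -/
def pull (t : Fin 3 → ∀ i, α i) (s : Finset (∀ i, α i)) : Finset (Pt ι) := univ.filter fun q => psi t q ∈ s

omit [∀ i, Fintype (α i)] in
/-- Pull-backs of up-sets are up-sets of `[3]^ι`. [this work] -/
theorem isUpperSet_pull (t : Fin 3 → ∀ i, α i) {s : Finset (∀ i, α i)} (hs : IsUpperSet (s : Set (∀ i, α i))) :
    IsUpperSet ((pull t s : Finset (Pt ι)) : Set (Pt ι)) := by
  intro q q' hqq' hq
  rw [Finset.mem_coe, pull, mem_filter] at hq ⊢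
  exact ⟨mem_univ _, hs (psi_monotone t hqq') hq.2⟩

omit [∀ i, Fintype (α i)] in
/-- Indicators pull back. [this work] -/
theorem chi_psi (t : Fin 3 → ∀ i, α i) (s : Finset (∀ i, α i)) (q : Pt ι) : chi s (psi t q) = chi (pull t s) q := by
  simp [chi, pull]

omit [Fintype ι] [DecidableEq ι] [∀ i, Fintype (α i)] in
/-- The triple `(srt t · ρ) · t` is `ψ_t` of the Latin triple indexed by `ρ`. [this work] -/
theorem act_srt_mul (t : Fin 3 → ∀ i, α i) (ρ : LPerm ι) : act (srt t * ρ) t = fun j => psi t (lpt ρ j) := by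
  funext j i; simp [act, psi, lpt, Pi.mul_apply, Equiv.Perm.mul_apply]

omit [∀ i, Fintype (α i)] in
/-- **Orbit sums are Latin kernels of the pulled-back triple.** [this work] -/
theorem orbitSum_eq_kappa (t : Fin 3 → ∀ i, α i) (a b c : Finset (∀ i, α i)) :
    ∑ π : LPerm ι, Gr a b c (act π t) = ((kappa (pull t a) (pull t b) (pull t c) : ℤ) : ℝ) := by
  rw [← Equiv.sum_comp (Equiv.mulLeft (srt t)) (fun π => Gr a b c (act π t)), kappa, Int.cast_sum]
  refine sum_congr rfl fun ρ _ => ?_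
  rw [Equiv.coe_mulLeft, act_srt_mul, ← Gr_eq_cast]
  simp only [Gr, chi_psi]

/-! ## Assembly -/

/-- **`E₃ ≥ 0` for three up-sets of `Π_i α_i` under a product probability weight, given FBP(3,|ι|).** [this work] -/
theorem sahiE_three_setInd_nonneg_pi (hpos : LatinPos ι) {w : ∀ i, α i → ℝ} (hw : ∀ i x, 0 ≤ w i x) (hμ : ∑ p, prodW w p = 1)
    {a b c : Finset (∀ i, α i)} (ha : IsUpperSet (a : Set (∀ i, α i))) (hb : IsUpperSet (b : Set (∀ i, α i)))
    (hc : IsUpperSet (c : Set (∀ i, α i))) : 0 ≤ sahiE (prodW w) 3 ![setInd a, setInd b, setInd c] :=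
  sahiE_three_setInd_nonneg_of_orbitSum_nonneg hw hμ a b c fun t => by
    rw [orbitSum_eq_kappa]
    exact_mod_cast hpos _ _ _ ⟨isUpperSet_pull t ha, isUpperSet_pull t hb, isUpperSet_pull t hc⟩

/-- **THEOREM (FBP(3,d) ⟹ Sahi positivity of order 3 on every product of `d` finite chains).**  If the Latin kernel is nonnegative on
all up-set triples of `[3]^ι`, then for ALL nonnegative weights `w_i` on finite linear orders `α_i` whose product weight has total
mass one, `prodW w` is Sahi-positive of order `3` on `Π_i α_i`. [this work] -/
theorem sahiPositive_three_prodW (hpos : LatinPos ι) (w : ∀ i, α i → ℝ) (hw : ∀ i x, 0 ≤ w i x) (hμ : ∑ p, prodW w p = 1) :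
    SahiPositive (prodW w) 3 := by
  rw [sahiPositive_iff_indicators]
  intro U hU
  have hf : (fun i => setInd (U i)) = ![setInd (U 0), setInd (U 1), setInd (U 2)] := by
    funext i; fin_cases i <;> rfl
  rw [hf]
  exact sahiE_three_setInd_nonneg_pi hpos hw hμ (hU 0) (hU 1) (hU 2)

omit [∀ i, LinearOrder (α i)] in
/-- The product of probability weights has total mass one. [this work] -/
theorem sum_prodW_eq_one {w : ∀ i, α i → ℝ} (hw1 : ∀ i, ∑ x, w i x = 1) : ∑ p, prodW w p = 1 := by
  simp only [prodW]
  rw [← Fintype.prod_sum (fun i x => w i x)]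
  simp [hw1]

/-- **THEOREM, marginal form.**  Given FBP(3,|ι|): for probability weights `w_i` (nonnegative, each of total mass one) on finite linear
orders `α_i`, the product weight `p ↦ Π_i w_i(p_i)` on `Π_i α_i` is Sahi-positive of order `3`. [this work] -/
theorem sahiPositive_three_prodW' (hpos : LatinPos ι) (w : ∀ i, α i → ℝ) (hw : ∀ i x, 0 ≤ w i x) (hw1 : ∀ i, ∑ x, w i x = 1) :
    SahiPositive (fun p : (∀ i, α i) => ∏ i, w i (p i)) 3 :=
  sahiPositive_three_prodW hpos w hw (sum_prodW_eq_one hw1)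

/-- **THEOREM (terminal positivity suffices).**  If the Latin kernel is nonnegative on the TERMINAL up-set triples of `[3]^ι`
(`TerminalPos ι`, a finite check), then Sahi's `E₃(f,g,h) ≥ 0` for all nonnegative monotone `f, g, h` on `Π_i α_i` under every
product probability weight — by the all-`d` descent theorem `latinPos_iff_terminalPos`. [this work] -/
theorem sahiPositive_three_of_terminalPos (hT : TerminalPos ι) (w : ∀ i, α i → ℝ) (hw : ∀ i x, 0 ≤ w i x)
    (hw1 : ∀ i, ∑ x, w i x = 1) : SahiPositive (fun p : (∀ i, α i) => ∏ i, w i (p i)) 3 :=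
  sahiPositive_three_prodW' (latinPos_iff_terminalPos.2 hT) w hw hw1

end Pi

end Summit.CriticalPhenomena.PercolationContinuityZ3.Theorems.SahiLatin
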